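import Literature.NumberTheory.EllipticCurves.HeegnerTraceRelationDividingProofs
import Literature.NumberTheory.EllipticCurves.HeegnerPointsOfConductorPrimeLevelProofs
import HarnessLib

/-!
# The norm relation at a prime DIVIDING THE LEVEL:
# `Tr_{K[pm]/K[m]} y(pm) = a_p · y(m)` for `p ∣ N`, `p ∣ m` (the `U_p`-relation of the Heegner points
# of `p`-power conductor on `X₀(N)`), hence `Tr_{K[pm]/K[m]} y(pm) = 0` at an additive prime `p`

Topic `NumberTheory/EllipticCurves` (complex multiplication / Heegner points; sequel of
`HeegnerTraceRelationDividingProofs` (`ℓ ∣ m`, `ℓ ∤ N`), `HeegnerTraceRelationProofs` (`ℓ ∤ Nm`) and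
`HeegnerPointsOfConductorPrimeLevelProofs` (the transport engine without `gcd(N, D) = 1`)), namespace
`Literature.NumberTheory.EllipticCurves` (helpers under `HeegnerTraceLevelDividing`). THEOREMS ONLY: no
definition, no named fact (D-0026); net Literature debt `0`.

## The statement

Let `E = W/ℚ` have a modular parametrisation datum `Dt` at level `N` (`φ = Dt.φ : ℍ → E(ℂ)`, `f = Dt.f` the
newform of `W` on `Γ₀(N)`), `K` imaginary quadratic, `β` an orientation (`4N ∣ β² − d_K`), and let
`x(k) = heegnerPointOfConductor d_K β k ∈ ℍ` be Gross's principal Heegner point of conductor `k` (the root of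
the primitive Heegner form `(k²(β² − d_K)/4, kβ, 1)` of level `N`), `y(k) = φ(x(k)) ∈ E(K[k])`
(`phi_heegnerPointOfConductor_mem_range_map_ringClassField_of_ne_zero`, every `k ≥ 1`). For a prime `p` and
`m ≥ 1` with `p ∣ m` — NO coprimality of `p` or `m` with `N`, NO `gcd(N, d_K) = 1` — and any
`y ∈ E(K[pm])` over `y(pm)`:

  `∑_{σ ∈ Gal(K[pm]/K[m])} (σ • y)_ℂ = a_p(W) • y(m)_ℂ − 𝟙_{p ∤ N} · y(m/p)_ℂ`,  `a_p(W) = W.LFunction p`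

(`map_sum_pointGalHom_eq_lFunction_smul_sub_ite`, `finsum_mem_ringClassGalOver_eq_lFunction_smul_sub_ite`).
For `p ∤ N` this is the tree's Darmon 2004, Prop. 3.10 (case `ℓ ∣ n`) freed of its hypothesis
`gcd(N, m) = 1` (`HeegnerTraceDividing.finsum_mem_ringClassGalOver_eq_frobeniusTrace_smul_sub`). For
**`p ∣ N`** the Hecke correspondence at `p` is `U_p`, the divisor `U_p(x(m))` consists of the `p` points
`(x(m) + i)/p`, `0 ≤ i < p`, which are exactly the `K[m]`-conjugates of `x(pm) = x(m)/p`, and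
`U_p f = a_p(f) f` gives

  `∑_{σ ∈ Gal(K[pm]/K[m])} (σ • y)_ℂ = a_p(W) • y(m)_ℂ`   (`…_of_dvd_level`),

and `= 0` when `a_p(W) = 0` (`…_eq_zero_of_lFunction_eq_zero`), in particular at a prime of ADDITIVE
reduction (`W.LFunction_apply_eq_zero_of_hasAdditiveReductionAt`: the Euler factor is `1`) —
`finsum_mem_ringClassGalOver_eq_zero_of_hasAdditiveReductionAt`. This is the vertical distribution relation
of the CM points of `p`-power conductor at a prime whose square divides the level: Cornut–Vatsal 2007,
§6 (distribution relations of `δ`-lattices, Lemma 6.5; Lemma 6.14 / Lemma 4.9 (iii): for `δ = v_p(N) ≥ 2`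
the trace of a good CM point of conductor `pⁿ` is `P`-old, hence killed in the `P`-new quotient, in
particular in `E`) — here for the principal (good) points of an elliptic curve over `ℚ`, with the exact
value `a_p · y(m)` (Perrin-Riou 1987 §3 / Howard 2004 Prop. 1.2.3 print the relation at `p ∤ N`).

## Proof

* §1 Lattice algebra: the lattices `L` with `Λ_τ ⊆ L ⊆ p⁻¹Λ_τ` (`Λ_τ = ℤτ + ℤ`) are `Λ_τ`, `p⁻¹Λ_τ`,
  `ℤτ + ℤp⁻¹ = p⁻¹Λ_{pτ}` and the `p` lattices `L_i = ℤ(τ + i)/p + ℤ` (`0 ≤ i < p`); and a lattice `L_N`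
  with `ℤ ⊆ L_N ⊆ L_i`, `pL_N ⊆ Λ_{Nτ}`, `N(τ + i)/p ∈ L_N` is `Λ_{N(τ+i)/p}` — for EVERY `p`, also `p ∣ N`
  (the level partner of a `U_p`-neighbour is forced).
* §2 Transport (the `p ∣ N` substitute for the classification of Hecke neighbours
  `exists_gamma0_smul_eq_of_isHeckeNeighbour`, which needs `p ∤ N`): for `σ ∈ Aut(ℂ/K[m])`, `p ∣ m`, the
  tree's primitive engine gives `LevelTransport N σ x(m) x(m)`
  (`levelTransport_heegnerPointOfConductor_self_of_fix_ringClassField`, any `m`), i.e.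
  `(Λ_{x(m)}, Λ_{Nx(m)})^σ = c(Λ_{x(m)}, Λ_{Nx(m)})`; transporting the inclusions
  `Λ_{x(m)} ⊆ Λ_{x(pm)} ⊆ p⁻¹Λ_{x(m)}` puts `c⁻¹Λ_{x(pm)}^σ` in the list of §1; its `j`-invariant
  `σ(j(x(pm)))` is NOT in `K[m]` (`kleinJ_heegnerPointOfConductor_mul_not_mem_ringClassField`), whereas
  `j(Λ_{x(m)})`, `j(p⁻¹Λ_{x(m)})` and `j(p⁻¹Λ_{p·x(m)}) = j(x(m/p))` are; so `c⁻¹Λ_{x(pm)}^σ = L_i` for some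
  `i < p`, the level partner is forced, and `LevelTransport N σ x(pm) ((x(m) + i)/p)`
  (`exists_levelTransport_tpB_of_fix_ringClassField`).
* §3 The adapter `G_p = Gal(K[pm]/K[m]) → Fin p` is injective (generator theorem
  `eqOn_ringClassField_of_levelTransport_of_gamma0_smul_eq`) and bijective by counting (`#G_p = p`,
  `HeegnerTraceDividing.card_ringClassGalOver_eq_of_dvd`).
* §4 `(g • y)_ℂ = σ_g ⋆ φ(x(pm)) = φ((x(m) + i g)/p)` (`ℚ`-rationality of `φ` in transport form,
  `transport_weierstrassP_values`), reindex, and apply Eichler–Shimura for ALL primes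
  (`ModularParametrizationData.lFunction_zsmul_φ`: `a_p • φ(τ) = ∑_{i mod p} φ((τ + i)/p) + 𝟙_{p ∤ N} φ(pτ)`),
  with `p · x(m) = x(m/p)` (`HeegnerTraceDividing.tpD_smul_heegnerPointOfConductor`).

## References

* [CornutVatsal2007] C. Cornut, V. Vatsal, *Nontriviality of Rankin–Selberg L-functions and CM points*,
  LMS LN 320 (2007), §1.3 (1.6), §4.3 Lemma 4.9, §6.2–6.4 (Def. 6.13, Lemma 6.5, Lemma 6.14)
  (held `book:burns2007-l-functions-galois-representations`, pp. 0160–0168, 0191, 0216).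
* [Darmon2004] H. Darmon, *Rational Points on Modular Elliptic Curves*, CBMS 101 (2004), §3.4 Prop. 3.10
  and its proof (pp. 35–36).
* [GrossLMS1991] B. H. Gross, *Kolyvagin's work on modular elliptic curves*, LMS LN 153 (1991), §3,
  Prop. 3.7 and its proof.
* [PerrinRiou1987BSMF] B. Perrin-Riou, *Fonctions L p-adiques, théorie d'Iwasawa et points de Heegner*,
  Bull. SMF 115 (1987), §3.
* [Howard2004] B. Howard, *The Heegner point Kolyvagin system*, Compos. Math. 140 (2004), §1.2.
* [Knapp1993] A. W. Knapp, *Elliptic Curves* (1993), Thm. 11.74 (b); [DiamondShurman2005] §5.2 (5.2)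
  (`T_p = U_p` for `p ∣ N`: the `p` cosets `β_j`).
* [SilvermanAEC2009] App. C §16 (`L_v(T) = 1` at an additive place: `a_p = 0`).

## Mathlib / tree search

Tree, by name: `heegnerPointOfConductor`, `heegnerPointOfConductor_mul_eq_tpB_smul`,
`kleinJ_heegnerPointOfConductor_mem_ringClassField`, `levelTransport_heegnerPointOfConductor_self_of_fix_ringClassField`,
`eqOn_ringClassField_of_levelTransport_of_gamma0_smul_eq`, `HeegnerTraceDividing.card_ringClassGalOver_eq_of_dvd`,
`HeegnerTraceDividing.kleinJ_heegnerPointOfConductor_mul_not_mem_ringClassField`,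
`HeegnerTraceDividing.tpD_smul_heegnerPointOfConductor`, `HeegnerTraceDividing.kleinJ_tpD_smul_mem_ringClassField`,
`PeriodPair.IsTransportedBy` (`.le`, `.mul_mem`, `.j_eq`), `exists_isTransportedBy`,
`LevelTransport.exists_lattice_eq`, `levelTransport_of_isTransportedBy`, `PeriodPair.mem_mulLeft_lattice`,
`PeriodPair.j_mulLeft`, `PeriodPair.j_eq_of_lattice_eq`, `kleinJ_eq_periodPair_j`, `coe_tpB_smul`, `coe_tpD_smul`,
`ModularParametrizationData.lFunction_zsmul_φ`, `transport_weierstrassP_values`, `exists_ringEquiv_apply_eq_algEquiv`,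
`WeierstrassCurve.LFunction_apply_eq_zero_of_hasAdditiveReductionAt`. `lean search 'of_dvd_level|LevelDividing|U_p'`:
only `phi_heegnerPointOfConductor_mem_range_map_ringClassField_of_prime_dvd_level` (rationality) before this
file; the trace files carry `hℓN : ¬ ℓ ∣ N` throughout.
-/

noncomputable section

open scoped Classical MatrixGroups
open Complex UpperHalfPlane CongruenceSubgroup NumberField Module PeriodPair
open Literature.NumberTheory.EllipticCurves.RingClassField
open Literature.NumberTheory.EllipticCurves.ModularForms

namespace Literature.NumberTheory.EllipticCurves

namespace HeegnerTraceLevelDividing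

open Literature.NumberTheory.EllipticCurves.HeegnerTraceDividing

/-! ## §1 Lattice algebra: the lattices between `Λ_τ` and `p⁻¹Λ_τ`, and the forced level partner -/

section LatticeAlgebra

/-- Membership in `ℤt + ℤ = span ℤ {t, 1}`. [folklore] -/
private theorem mem_span_pair_one_iff {t x : ℂ} :
    x ∈ Submodule.span ℤ ({t, 1} : Set ℂ) ↔ ∃ m n : ℤ, (m : ℂ) * t + n = x := by
  simp only [Submodule.mem_span_pair, zsmul_eq_mul, mul_one]

/-- Membership in `span ℤ {t, s}`. [folklore] -/
private theorem mem_span_pair_iff' {t s x : ℂ} :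
    x ∈ Submodule.span ℤ ({t, s} : Set ℂ) ↔ ∃ m n : ℤ, (m : ℂ) * t + n * s = x := by
  simp only [Submodule.mem_span_pair, zsmul_eq_mul]

/-- `mt + n ∈ ℤt + ℤ`. [folklore] -/
private theorem intCast_mul_add_mem (t : ℂ) (m n : ℤ) :
    (m : ℂ) * t + n ∈ Submodule.span ℤ ({t, 1} : Set ℂ) :=
  mem_span_pair_one_iff.mpr ⟨m, n, rfl⟩

/-- `t ∈ ℤt + ℤ`. [folklore] -/
private theorem self_mem_span (t : ℂ) : t ∈ Submodule.span ℤ ({t, 1} : Set ℂ) :=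
  Submodule.subset_span (Set.mem_insert t _)

/-- `1 ∈ ℤt + ℤ`. [folklore] -/
private theorem one_mem_span (t : ℂ) : (1 : ℂ) ∈ Submodule.span ℤ ({t, 1} : Set ℂ) :=
  Submodule.subset_span (Set.mem_insert_of_mem t rfl)

/-- Uniqueness of coordinates: for `t ∉ ℝ`, `mt + n = m't + n'` forces `m = m'`, `n = n'`. [folklore] -/
private theorem intCast_coord_unique {t : ℂ} (ht : t.im ≠ 0) {m n m' n' : ℤ}
    (h : (m : ℂ) * t + n = (m' : ℂ) * t + n') : m = m' ∧ n = n' := by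
  have him := congrArg Complex.im h
  simp only [add_im, mul_im, intCast_re, intCast_im, zero_mul, add_zero] at him
  have hm : (m : ℝ) = m' := mul_right_cancel₀ ht him
  have hm' : m = m' := by exact_mod_cast hm
  subst hm'
  have hn : (n : ℂ) = n' := add_left_cancel h
  exact ⟨rfl, by exact_mod_cast hn⟩

/-- If `px ∈ ℤt + ℤ` then `x = (at + b)/p` for integers `a, b`. [folklore] -/
private theorem exists_eq_div_of_mul_mem {t x : ℂ} {p : ℕ} (hp0 : (p : ℂ) ≠ 0)
    (h : (p : ℂ) * x ∈ Submodule.span ℤ ({t, 1} : Set ℂ)) :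
    ∃ a b : ℤ, x = ((a : ℂ) * t + b) / p := by
  obtain ⟨a, b, hab⟩ := mem_span_pair_one_iff.mp h
  exact ⟨a, b, by rw [hab]; field_simp⟩

/-- An integer prime to the prime `p` is invertible modulo `p`: `au = 1 + kp`. [folklore] -/
private theorem exists_mul_eq_one_add {p : ℕ} (hp : p.Prime) {a : ℤ} (ha : ¬ (p : ℤ) ∣ a) :
    ∃ u k : ℤ, a * u = 1 + k * p := by
  haveI := Fact.mk hp
  have ha' : (a : ZMod p) ≠ 0 := by rwa [Ne, ZMod.intCast_zmod_eq_zero_iff_dvd]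
  have h : (((a * (((a : ZMod p)⁻¹).val : ℤ) - 1 : ℤ) : ZMod p)) = 0 := by
    push_cast
    rw [ZMod.natCast_zmod_val, mul_inv_cancel₀ ha', sub_self]
  obtain ⟨k, hk⟩ := (ZMod.intCast_zmod_eq_zero_iff_dvd _ p).mp h
  exact ⟨(((a : ZMod p)⁻¹).val : ℤ), k, by linear_combination hk⟩

/-- From an element `(at + b)/p ∈ M` with `p ∤ a`: some `(t + j)/p ∈ M`, `0 ≤ j < p`. [folklore] -/
private theorem exists_div_mem_of_not_dvd {t : ℂ} {p : ℕ} (hp : p.Prime) {M : Submodule ℤ ℂ}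
    (h1 : Submodule.span ℤ ({t, 1} : Set ℂ) ≤ M) {a b : ℤ} (hx : ((a : ℂ) * t + b) / p ∈ M)
    (ha : ¬ (p : ℤ) ∣ a) : ∃ j : ℤ, 0 ≤ j ∧ j < p ∧ (t + j) / p ∈ M := by
  have hp0 : (p : ℂ) ≠ 0 := by exact_mod_cast hp.ne_zero
  have hp0' : (p : ℤ) ≠ 0 := by exact_mod_cast hp.ne_zero
  obtain ⟨u, k, huk⟩ := exists_mul_eq_one_add hp ha
  have hmem : (t + (u * b : ℤ)) / p ∈ M := by
    have h : u • (((a : ℂ) * t + b) / p) - k • t ∈ M :=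
      M.sub_mem (M.smul_mem u hx) (M.smul_mem k (h1 (self_mem_span t)))
    rw [zsmul_eq_mul, zsmul_eq_mul] at h
    convert h using 1
    have hukC : (a : ℂ) * u = 1 + k * p := by exact_mod_cast huk
    field_simp
    push_cast
    linear_combination (-t) * hukC
  obtain ⟨q, j, hqj, hj0, hjp⟩ : ∃ q j : ℤ, u * b = j + p * q ∧ 0 ≤ j ∧ j < p :=
    ⟨u * b / p, u * b % p, (Int.emod_add_mul_ediv _ _).symm, Int.emod_nonneg _ hp0',
      Int.emod_lt_of_pos _ (by exact_mod_cast hp.pos)⟩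
  refine ⟨j, hj0, hjp, ?_⟩
  have h : (t + (u * b : ℤ)) / p - q • (1 : ℂ) ∈ M :=
    M.sub_mem hmem (M.smul_mem _ (h1 (one_mem_span t)))
  rw [zsmul_eq_mul, mul_one] at h
  convert h using 1
  have hqjC : ((u * b : ℤ) : ℂ) = j + p * q := by exact_mod_cast hqj
  rw [hqjC]
  field_simp
  ring

/-- From an element `(at + b)/p ∈ M` with `p ∣ a`, `p ∤ b`: `p⁻¹ ∈ M`. [folklore] -/
private theorem inv_mem_of_dvd_of_not_dvd {t : ℂ} {p : ℕ} (hp : p.Prime) {M : Submodule ℤ ℂ}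
    (h1 : Submodule.span ℤ ({t, 1} : Set ℂ) ≤ M) {a b : ℤ} (hx : ((a : ℂ) * t + b) / p ∈ M)
    (ha : (p : ℤ) ∣ a) (hb : ¬ (p : ℤ) ∣ b) : (p : ℂ)⁻¹ ∈ M := by
  have hp0 : (p : ℂ) ≠ 0 := by exact_mod_cast hp.ne_zero
  obtain ⟨a', rfl⟩ := ha
  obtain ⟨u, k, huk⟩ := exists_mul_eq_one_add hp hb
  have h : u • ((((p * a' : ℤ) : ℂ) * t + b) / p) - (u * a') • t - k • (1 : ℂ) ∈ M :=
    M.sub_mem (M.sub_mem (M.smul_mem u hx) (M.smul_mem _ (h1 (self_mem_span t))))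
      (M.smul_mem k (h1 (one_mem_span t)))
  rw [zsmul_eq_mul, zsmul_eq_mul, zsmul_eq_mul] at h
  convert h using 1
  have hukC : (b : ℂ) * u = 1 + k * p := by exact_mod_cast huk
  field_simp
  push_cast
  linear_combination -hukC

/-- `(t + j)/p ∈ M` and `p⁻¹ ∈ M` force `p⁻¹(ℤt + ℤ) ⊆ M`. [folklore] -/
private theorem forall_inv_mul_mem {t : ℂ} {p : ℕ} (hp : p.Prime) {M : Submodule ℤ ℂ} {j : ℤ}
    (hj : (t + j) / p ∈ M) (hinv : (p : ℂ)⁻¹ ∈ M) :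
    ∀ x ∈ Submodule.span ℤ ({t, 1} : Set ℂ), (p : ℂ)⁻¹ * x ∈ M := by
  have hp0 : (p : ℂ) ≠ 0 := by exact_mod_cast hp.ne_zero
  intro x hx
  obtain ⟨m, n, rfl⟩ := mem_span_pair_one_iff.mp hx
  have h : m • ((t + j) / p) + (n - m * j) • (p : ℂ)⁻¹ ∈ M :=
    M.add_mem (M.smul_mem m hj) (M.smul_mem _ hinv)
  rw [zsmul_eq_mul, zsmul_eq_mul] at h
  convert h using 1
  push_cast
  field_simp
  ring

/-- **The lattices between `Λ = ℤt + ℤ` and `p⁻¹Λ`** (`p` prime, `t ∉ ℝ`): a `ℤ`-submodule `M` with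
`Λ ⊆ M ⊆ p⁻¹Λ` is one of `ℤ(t + j)/p + ℤ` (`0 ≤ j < p`), `ℤt + ℤp⁻¹`, `p⁻¹Λ` (it contains `p⁻¹Λ`) or `Λ`
itself — the subgroups of `p⁻¹Λ/Λ ≅ (ℤ/p)²` (Diamond–Shurman §5.2; Serre, *A Course in Arithmetic*,
VII §5.1). [folklore] -/
private theorem classify_sublattice {t : ℂ} (ht : t.im ≠ 0) {p : ℕ} (hp : p.Prime)
    {M : Submodule ℤ ℂ} (h1 : Submodule.span ℤ ({t, 1} : Set ℂ) ≤ M)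
    (h2 : ∀ x ∈ M, (p : ℂ) * x ∈ Submodule.span ℤ ({t, 1} : Set ℂ)) :
    (∃ j : ℤ, 0 ≤ j ∧ j < p ∧ M = Submodule.span ℤ ({(t + j) / p, 1} : Set ℂ)) ∨
      M = Submodule.span ℤ ({t, (p : ℂ)⁻¹} : Set ℂ) ∨
      (∀ x ∈ Submodule.span ℤ ({t, 1} : Set ℂ), (p : ℂ)⁻¹ * x ∈ M) ∨
      M = Submodule.span ℤ ({t, 1} : Set ℂ) := by
  have hp0 : (p : ℂ) ≠ 0 := by exact_mod_cast hp.ne_zero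
  by_cases hle : M ≤ Submodule.span ℤ ({t, 1} : Set ℂ)
  · exact Or.inr (Or.inr (Or.inr (le_antisymm hle h1)))
  obtain ⟨x, hxM, hxL⟩ := Set.not_subset.mp hle
  rw [SetLike.mem_coe] at hxM hxL
  obtain ⟨a, b, rfl⟩ := exists_eq_div_of_mul_mem hp0 (h2 x hxM)
  by_cases h4 : ∀ y ∈ Submodule.span ℤ ({t, 1} : Set ℂ), (p : ℂ)⁻¹ * y ∈ M
  · exact Or.inr (Or.inr (Or.inl h4))
  by_cases ha : (p : ℤ) ∣ a
  · -- then `p ∤ b`, and `M = ℤt + ℤp⁻¹`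
    have hb : ¬ (p : ℤ) ∣ b := by
      rintro ⟨b', rfl⟩
      obtain ⟨a', rfl⟩ := ha
      apply hxL
      have h := intCast_mul_add_mem t a' b'
      convert h using 1
      push_cast
      field_simp
    have hinv := inv_mem_of_dvd_of_not_dvd hp h1 hxM ha hb
    refine Or.inr (Or.inl (le_antisymm ?_ ?_))
    · intro y hy
      obtain ⟨a₂, b₂, rfl⟩ := exists_eq_div_of_mul_mem hp0 (h2 y hy)
      by_cases ha₂ : (p : ℤ) ∣ a₂
      · obtain ⟨a₂', rfl⟩ := ha₂
        refine mem_span_pair_iff'.mpr ⟨a₂', b₂, ?_⟩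
        push_cast
        field_simp
      · exfalso
        obtain ⟨j, -, -, hj⟩ := exists_div_mem_of_not_dvd hp h1 hy ha₂
        exact h4 (forall_inv_mul_mem hp hj hinv)
    · rw [Submodule.span_le]
      rintro y (rfl | hy)
      · exact h1 (self_mem_span y)
      · rw [Set.mem_singleton_iff] at hy
        subst hy
        exact hinv
  · -- `p ∤ a`: `M = ℤ(t + j)/p + ℤ`
    obtain ⟨j, hj0, hjp, hjM⟩ := exists_div_mem_of_not_dvd hp h1 hxM ha
    refine Or.inl ⟨j, hj0, hjp, le_antisymm ?_ ?_⟩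
    · intro y hy
      obtain ⟨a₂, b₂, rfl⟩ := exists_eq_div_of_mul_mem hp0 (h2 y hy)
      by_cases hd : (p : ℤ) ∣ (b₂ - a₂ * j)
      · obtain ⟨c, hc⟩ := hd
        refine mem_span_pair_one_iff.mpr ⟨a₂, c, ?_⟩
        have hcC : (b₂ : ℂ) - a₂ * j = p * c := by exact_mod_cast hc
        field_simp
        linear_combination -hcC
      · exfalso
        have hmem : (((0 : ℤ) : ℂ) * t + (b₂ - a₂ * j : ℤ)) / p ∈ M := by
          have h := M.sub_mem hy (M.smul_mem a₂ hjM)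
          rw [zsmul_eq_mul] at h
          convert h using 1
          push_cast
          field_simp
          ring
        have hinv := inv_mem_of_dvd_of_not_dvd hp h1 hmem (dvd_zero _) hd
        exact h4 (forall_inv_mul_mem hp hjM hinv)
    · rw [Submodule.span_le]
      rintro y (rfl | hy)
      · exact hjM
      · rw [Set.mem_singleton_iff] at hy
        subst hy
        exact h1 (one_mem_span t)

/-- **The level partner of a `U_p`-neighbour is forced** (every `p`, also `p ∣ N`): a `ℤ`-submodule
`L_N` with `1 ∈ L_N ⊆ ℤ(t + j)/p + ℤ`, `pL_N ⊆ ℤNt + ℤ` and `N(t + j)/p ∈ L_N` equals `ℤN(t + j)/p + ℤ`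
— among the superlattices of `Λ_{Nτ}` of index `p`, exactly one lies in `Λ_{(τ+j)/p}`, namely
`Λ_{N(τ+j)/p}` (Diamond–Shurman §5.2: `C' = (C + Λ')/Λ'`). [folklore] -/
private theorem levelPartner_eq_span {t : ℂ} (ht : t.im ≠ 0) {p N : ℕ} (hp0 : (p : ℂ) ≠ 0) (j : ℤ)
    {L : Submodule ℤ ℂ} (h1 : (1 : ℂ) ∈ L)
    (h2 : ∀ x ∈ L, (p : ℂ) * x ∈ Submodule.span ℤ ({(N : ℂ) * t, 1} : Set ℂ))
    (h3 : L ≤ Submodule.span ℤ ({(t + j) / p, 1} : Set ℂ))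
    (h4 : (N : ℂ) * ((t + j) / p) ∈ L) :
    L = Submodule.span ℤ ({(N : ℂ) * ((t + j) / p), 1} : Set ℂ) := by
  refine le_antisymm ?_ ?_
  · intro x hx
    obtain ⟨m, n, rfl⟩ := mem_span_pair_one_iff.mp (h3 hx)
    obtain ⟨m', n', hmn⟩ := mem_span_pair_one_iff.mp (h2 _ hx)
    -- `p · (m (t+j)/p + n) = m t + (m j + p n)` versus `m' N t + n'`
    have hcoord : ((m' * N : ℤ) : ℂ) * t + n' = (m : ℂ) * t + (m * j + p * n : ℤ) := by
      push_cast
      rw [mul_assoc, hmn]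
      field_simp
      ring
    obtain ⟨hm, -⟩ := intCast_coord_unique ht hcoord
    refine mem_span_pair_one_iff.mpr ⟨m', n, ?_⟩
    rw [← hm]
    push_cast
    ring
  · rw [Submodule.span_le]
    rintro y (rfl | hy)
    · exact h4
    · rw [Set.mem_singleton_iff] at hy
      subst hy
      exact h1

/-- `ℤt + ℤ ⊆ ℤt/p + ℤ` (`t = p · (t/p)`). [folklore] -/
private theorem span_le_span_div (t : ℂ) {p : ℕ} (hp0 : (p : ℂ) ≠ 0) :
    Submodule.span ℤ ({t, 1} : Set ℂ) ≤ Submodule.span ℤ ({t / p, 1} : Set ℂ) := by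
  rw [Submodule.span_le]
  rintro x (rfl | hx)
  · have h := intCast_mul_add_mem (x / p) p 0
    simp only [Int.cast_natCast, Int.cast_zero, add_zero, SetLike.mem_coe] at h ⊢
    convert h using 1
    field_simp
  · rw [Set.mem_singleton_iff] at hx
    subst hx
    exact one_mem_span _

/-- `p · (ℤt/p + ℤ) ⊆ ℤt + ℤ`. [folklore] -/
private theorem mul_mem_span_of_mem_span_div (t : ℂ) {p : ℕ} (hp0 : (p : ℂ) ≠ 0) :
    ∀ x ∈ Submodule.span ℤ ({t / p, 1} : Set ℂ), (p : ℂ) * x ∈ Submodule.span ℤ ({t, 1} : Set ℂ) := by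
  intro x hx
  obtain ⟨m, n, rfl⟩ := mem_span_pair_one_iff.mp hx
  have h := intCast_mul_add_mem t m (n * p)
  convert h using 1
  push_cast
  field_simp

end LatticeAlgebra

/-! ## §2 Transport of the `U_p`-neighbour `x(pm) = x(m)/p` along `σ ∈ Aut(ℂ/K[m])` — every prime `p` -/

variable {K : Type} [Field K] [NumberField K]

/-- `4 ∣ β² − D` from `4N ∣ β² − D`. [folklore] -/
private theorem four_dvd_of_dvd {N : ℕ} {D β : ℤ} (hβ : (4 * N : ℤ) ∣ β ^ 2 - D) :
    (4 : ℤ) ∣ β ^ 2 - D :=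
  (Dvd.intro _ rfl : (4 : ℤ) ∣ 4 * N).trans hβ

/-- If `σ` fixes `F` pointwise and `σ y ∈ F`, then `y ∈ F` (indeed `y = σ y`). [folklore] -/
private theorem mem_of_apply_eq_of_mem {F : Subfield ℂ} {σ : ℂ ≃+* ℂ} (hσ : ∀ x ∈ F, σ x = x)
    {y z : ℂ} (h : σ y = z) (hz : z ∈ F) : y ∈ F := by
  have h' : σ y = σ z := by rw [h, hσ z hz]
  rw [σ.injective h']
  exact hz

/-- **Transport of the `U_p`-neighbour.** Let `K` be imaginary quadratic, `4N ∣ β² − d_K`, `p` ANY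
prime (`p ∣ N` allowed), `p ∣ m`, `m ≥ 1`, and `σ ∈ Aut(ℂ)` fixing `K[m]` pointwise. Then `σ` carries the
level-`N` structure of `x(pm) = x(m)/p` to that of `(x(m) + j)/p` for some `0 ≤ j < p`:
`LevelTransport N σ x(pm) ((x(m) + j)/p)`. Proof: §1 applied to `c⁻¹Λ_{x(pm)}^σ`, where
`(Λ_{x(m)}, Λ_{Nx(m)})^σ = c(Λ_{x(m)}, Λ_{Nx(m)})` is the tree's primitive engine
(`levelTransport_heegnerPointOfConductor_self_of_fix_ringClassField`, no `gcd(N, m d_K) = 1`); the three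
other lattices of the list have `j`-invariant `j(x(m))` or `j(x(m/p))` in `K[m]`, while
`j(Λ_{x(pm)}^σ) = σ(j(x(pm))) ∉ K[m]`; the level partner is forced (`levelPartner_eq_span`). For `p ∤ N`
this is the tree's `exists_isHeckeNeighbour_levelTransport_of_fix` + `exists_gamma0_smul_eq_of_isHeckeNeighbour`
without `gcd(N, m) = 1`; for `p ∣ N` it says that the conjugates of `x(pm)` lie in the divisor `U_p(x(m))`.
[cite: GrossLMS1991, §3 (proof of Prop. 3.7: the points of T_ℓ(x_m) are the conjugates of x_n)]
[cite: CornutVatsal2007, §6.2 Lemma 6.5 (distribution relations of lattices)] -/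
theorem exists_levelTransport_tpB_of_fix_ringClassField (hK : IsImaginaryQuadratic K) (ι : K →+* ℂ)
    {N : ℕ} [NeZero N] {β : ℤ} (hβ : (4 * N : ℤ) ∣ β ^ 2 - NumberField.discr K) {p m : ℕ}
    (hp : p.Prime) (hpm : p ∣ m) (hm : m ≠ 0) [NeZero p] {σ : ℂ ≃+* ℂ}
    (hσ : ∀ x ∈ ringClassField K ι m, σ x = x) :
    ∃ j : Fin p, LevelTransport N σ (heegnerPointOfConductor (NumberField.discr K) β (p * m))
      (tpB p ((j : ℕ) : ℤ) • heegnerPointOfConductor (NumberField.discr K) β m) := by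
  set D : ℤ := NumberField.discr K with hDdef
  set τ : ℍ := heegnerPointOfConductor D β m with hτdef
  have hD : D < 0 := hK.discr_neg
  have hp0 : (p : ℂ) ≠ 0 := by exact_mod_cast hp.ne_zero
  have ht : (τ : ℂ).im ≠ 0 := τ.im_pos.ne'
  have hτ₁ : heegnerPointOfConductor D β (p * m) = tpB p 0 • τ :=
    heegnerPointOfConductor_mul_eq_tpB_smul hD (four_dvd_of_dvd hβ) hm
  set τ₁ : ℍ := tpB p 0 • τ with hτ₁def
  have hcoe₁ : (τ₁ : ℂ) = (τ : ℂ) / p := by rw [hτ₁def, coe_tpB_smul, Int.cast_zero, add_zero]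
  -- the `j`-invariants in play
  have hnot : kleinJ τ₁ ∉ ringClassField K ι m := by
    rw [← hτ₁]; exact kleinJ_heegnerPointOfConductor_mul_not_mem_ringClassField hK ι hβ hp hpm hm
  have hjτ : kleinJ τ ∈ ringClassField K ι m := kleinJ_heegnerPointOfConductor_mem_ringClassField hK ι hβ hm
  have hjD : kleinJ (tpD p • τ) ∈ ringClassField K ι m :=
    kleinJ_tpD_smul_mem_ringClassField hK ι hβ (ℓ := p) hpm hm
  -- self-transport of `x(m)` and the four transported lattices
  have hT0 : LevelTransport N σ τ τ :=
    levelTransport_heegnerPointOfConductor_self_of_fix_ringClassField hK ι hβ hm hσ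
  obtain ⟨M, hM⟩ := exists_isTransportedBy σ (ofUpperHalfPlane τ)
  obtain ⟨M_N, hMN⟩ := exists_isTransportedBy σ (ofUpperHalfPlane (levelPoint N τ))
  obtain ⟨c, hc, hMc, hMNc⟩ := hT0.exists_lattice_eq hM hMN
  obtain ⟨M₁, hM₁⟩ := exists_isTransportedBy σ (ofUpperHalfPlane τ₁)
  obtain ⟨M₁N, hM₁N⟩ := exists_isTransportedBy σ (ofUpperHalfPlane (levelPoint N τ₁))
  have hjM₁ : M₁.j = σ (kleinJ τ₁) := by rw [hM₁.j_eq, kleinJ_eq_periodPair_j]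
  -- the lattices of `τ`, `τ₁` as spans
  have hΛ : (ofUpperHalfPlane τ).lattice = Submodule.span ℤ ({(τ : ℂ), 1} : Set ℂ) := rfl
  have hΛN : (ofUpperHalfPlane (levelPoint N τ)).lattice =
      Submodule.span ℤ ({(N : ℂ) * τ, 1} : Set ℂ) := rfl
  have hΛ₁ : (ofUpperHalfPlane τ₁).lattice = Submodule.span ℤ ({(τ : ℂ) / p, 1} : Set ℂ) := by
    change Submodule.span ℤ ({(τ₁ : ℂ), 1} : Set ℂ) = _; rw [hcoe₁]
  have hΛ₁N : (ofUpperHalfPlane (levelPoint N τ₁)).lattice =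
      Submodule.span ℤ ({(N : ℂ) * τ / p, 1} : Set ℂ) := by
    change Submodule.span ℤ ({((levelPoint N τ₁ : ℍ) : ℂ), 1} : Set ℂ) = _
    rw [coe_levelPoint, hcoe₁, mul_div_assoc]
  -- `L = c⁻¹ Λ_{τ₁}^σ` lies between `Λ_τ` and `p⁻¹Λ_τ`
  set L : PeriodPair := M₁.mulLeft c⁻¹ (inv_ne_zero hc) with hLdef
  have hmemL : ∀ x, x ∈ L.lattice ↔ c * x ∈ M₁.lattice := fun x => by
    rw [hLdef, mem_mulLeft_lattice, inv_inv]
  have hle₁ : M.lattice ≤ M₁.lattice := hM.le hM₁ (by rw [hΛ, hΛ₁]; exact span_le_span_div _ hp0)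
  have hmul₁ : ∀ x ∈ M₁.lattice, (p : ℂ) * x ∈ M.lattice := by
    have h := hM₁.mul_mem hM (c := (p : ℂ)) (by rw [hΛ, hΛ₁]; exact mul_mem_span_of_mem_span_div _ hp0)
    rwa [map_natCast] at h
  have h1 : Submodule.span ℤ ({(τ : ℂ), 1} : Set ℂ) ≤ L.lattice := by
    intro x hx
    rw [hmemL]
    exact hle₁ (hMc ▸ mul_mem_mulLeft_lattice.mpr (hΛ ▸ hx))
  have h2 : ∀ x ∈ L.lattice, (p : ℂ) * x ∈ Submodule.span ℤ ({(τ : ℂ), 1} : Set ℂ) := by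
    intro x hx
    rw [hmemL] at hx
    have h := hmul₁ _ hx
    rw [hMc, mem_mulLeft_lattice, mul_left_comm, inv_mul_cancel_left₀ hc] at h
    exact h
  have hjL : L.j = σ (kleinJ τ₁) := by rw [hLdef, j_mulLeft, hjM₁]
  -- classify `L`; three cases contradict `j(x(pm)) ∉ K[m]`
  rcases classify_sublattice ht hp h1 h2 with ⟨j, hj0, hjp, hLj⟩ | hLD | hLinv | hLΛ
  rotate_left
  · -- `L = ℤτ + ℤp⁻¹ = p⁻¹Λ_{pτ}`: `j(L) = j(p·x(m)) = j(x(m/p)) ∈ K[m]`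
    exfalso
    apply hnot
    refine mem_of_apply_eq_of_mem hσ (hjL.symm.trans ?_) hjD
    have hlat : L.lattice = ((ofUpperHalfPlane (tpD p • τ)).mulLeft (p : ℂ)⁻¹ (inv_ne_zero hp0)).lattice := by
      rw [hLD]
      change _ = Submodule.span ℤ ({(p : ℂ)⁻¹ * ((tpD p • τ : ℍ) : ℂ), (p : ℂ)⁻¹ * 1} : Set ℂ)
      rw [coe_tpD_smul, inv_mul_cancel_left₀ hp0, mul_one]
    rw [j_eq_of_lattice_eq hlat, j_mulLeft, kleinJ_eq_periodPair_j]
  · -- `L ⊇ p⁻¹Λ_τ`, so `L = p⁻¹Λ_τ`: `j(L) = j(x(m)) ∈ K[m]`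
    exfalso
    apply hnot
    refine mem_of_apply_eq_of_mem hσ (hjL.symm.trans ?_) hjτ
    have hlat : L.lattice = ((ofUpperHalfPlane τ).mulLeft (p : ℂ)⁻¹ (inv_ne_zero hp0)).lattice := by
      ext x
      rw [mem_mulLeft_lattice (L := ofUpperHalfPlane τ) (c := (p : ℂ)⁻¹), inv_inv]
      constructor
      · exact h2 x
      · intro hx
        have h := hLinv _ hx
        rwa [inv_mul_cancel_left₀ hp0] at h
    rw [j_eq_of_lattice_eq hlat, j_mulLeft, kleinJ_eq_periodPair_j]
  · -- `L = Λ_τ`: `j(L) = j(x(m)) ∈ K[m]`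
    exfalso
    apply hnot
    refine mem_of_apply_eq_of_mem hσ (hjL.symm.trans ?_) hjτ
    rw [j_eq_of_lattice_eq (hLΛ.trans hΛ.symm), kleinJ_eq_periodPair_j]
  -- the good case: `L = ℤ(τ + j)/p + ℤ = Λ_{(x(m)+j)/p}`
  set τj : ℍ := tpB p j • τ with hτjdef
  have hcoej : (τj : ℂ) = ((τ : ℂ) + j) / p := by rw [hτjdef, coe_tpB_smul]
  have hΛj : (ofUpperHalfPlane τj).lattice = Submodule.span ℤ ({((τ : ℂ) + j) / p, 1} : Set ℂ) := by
    change Submodule.span ℤ ({(τj : ℂ), 1} : Set ℂ) = _; rw [hcoej]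
  have hΛjN : (ofUpperHalfPlane (levelPoint N τj)).lattice =
      Submodule.span ℤ ({(N : ℂ) * (((τ : ℂ) + j) / p), 1} : Set ℂ) := by
    change Submodule.span ℤ ({((levelPoint N τj : ℍ) : ℂ), 1} : Set ℂ) = _
    rw [coe_levelPoint, hcoej]
  have hM₁eq : M₁.lattice = ((ofUpperHalfPlane τj).mulLeft c hc).lattice := by
    ext x
    rw [mem_mulLeft_lattice, hΛj, ← hLj, hmemL, mul_inv_cancel_left₀ hc]
  -- the level partner `L_N = c⁻¹ Λ_{Nτ₁}^σ`
  set LN : PeriodPair := M₁N.mulLeft c⁻¹ (inv_ne_zero hc) with hLNdef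
  have hmemLN : ∀ x, x ∈ LN.lattice ↔ c * x ∈ M₁N.lattice := fun x => by
    rw [hLNdef, mem_mulLeft_lattice, inv_inv]
  have hN1 : (1 : ℂ) ∈ LN.lattice := by
    rw [hmemLN]
    have hle : M_N.lattice ≤ M₁N.lattice := hMN.le hM₁N (by
      rw [hΛN, hΛ₁N]
      exact span_le_span_div _ hp0)
    refine hle ?_
    rw [hMNc]
    exact mul_mem_mulLeft_lattice.mpr (ω₂_mem_lattice _)
  have hN2 : ∀ x ∈ LN.lattice, (p : ℂ) * x ∈ Submodule.span ℤ ({(N : ℂ) * τ, 1} : Set ℂ) := by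
    intro x hx
    rw [hmemLN] at hx
    have hmul : ∀ y ∈ M₁N.lattice, (p : ℂ) * y ∈ M_N.lattice := by
      have h := hM₁N.mul_mem hMN (c := (p : ℂ)) (by
        rw [hΛN, hΛ₁N]
        exact mul_mem_span_of_mem_span_div _ hp0)
      rwa [map_natCast] at h
    have h := hmul _ hx
    rw [hMNc, mem_mulLeft_lattice, mul_left_comm, inv_mul_cancel_left₀ hc] at h
    exact h
  have hN3 : LN.lattice ≤ Submodule.span ℤ ({((τ : ℂ) + j) / p, 1} : Set ℂ) := by
    intro x hx
    rw [hmemLN] at hx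
    rw [← hLj, hmemL]
    exact hM₁N.le hM₁ (lattice_levelPoint_le τ₁) hx
  have hN4 : (N : ℂ) * (((τ : ℂ) + j) / p) ∈ LN.lattice := by
    rw [hmemLN]
    have hmem : c * (((τ : ℂ) + j) / p) ∈ M₁.lattice := by
      rw [← hmemL, hLj]
      exact self_mem_span _
    have h := hM₁.mul_mem hM₁N (c := (N : ℂ)) (natCast_mul_mem_lattice_levelPoint τ₁) _ hmem
    rw [map_natCast] at h
    convert h using 1
    ring
  have hLNeq := levelPartner_eq_span ht hp0 j hN1 hN2 hN3 hN4
  have hM₁Neq : M₁N.lattice = ((ofUpperHalfPlane (levelPoint N τj)).mulLeft c hc).lattice := by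
    ext x
    rw [mem_mulLeft_lattice, hΛjN, ← hLNeq, hmemLN, mul_inv_cancel_left₀ hc]
  refine ⟨⟨j.toNat, (Int.toNat_lt hj0).mpr hjp⟩, ?_⟩
  rw [hτ₁]
  simp only [Int.toNat_of_nonneg hj0]
  exact levelTransport_of_isTransportedBy hM₁ hM₁N hc hM₁eq hM₁Neq

/-! ## §3 `φ` along level transport; extensions of `g ∈ G_p` (copies of the private helpers of
`HeegnerTraceRelationDividingProofs`) -/

/-- **`σ ⋆ φ(τ) = φ(τ')` whenever `σ ∈ Aut(ℂ)` transports the level-`N` structure of `τ` to that of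
`τ'`** (`LevelTransport N σ τ τ'`), for every modular parametrisation datum `Dt` of `W/ℚ`
(`transport_weierstrassP_values` read through `uniformize_spec`; copy of the private helper of
`HeegnerTraceRelationDividingProofs`). [cite: ShimuraIATAF1971, Thm. 7.14] [cite: Darmon2004, Thm. 3.6 (proof)] -/
private theorem map_φ_of_levelTransport {W : WeierstrassCurve ℚ} {N : ℕ} [NeZero N]
    (Dt : ModularParametrizationData W N) {σ : ℂ ≃+* ℂ} {τ τ' : ℍ}
    (hT : LevelTransport N σ τ τ') :
    WeierstrassCurve.Affine.Point.map (σ : ℂ →+* ℂ).toRatAlgHom (Dt.φ τ) = Dt.φ τ' := by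
  obtain ⟨hiff, hval⟩ := Dt.transport_weierstrassP_values σ hT
  set z : ℂ := (Dt.c : ℂ) * eichlerIntegral Dt.f τ with hz_def
  set z' : ℂ := (Dt.c : ℂ) * eichlerIntegral Dt.f τ' with hz'_def
  change WeierstrassCurve.Affine.Point.map _ (Dt.uniformize z) = Dt.uniformize z'
  by_cases hz : z ∈ Dt.L.lattice
  · rw [(Dt.uniformize_eq_zero_iff z).mpr hz, (Dt.uniformize_eq_zero_iff z').mpr (hiff.mp hz),
      map_zero]
  · have hz' : z' ∉ Dt.L.lattice := fun h' => hz (hiff.mpr h')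
    obtain ⟨h₁, h₂⟩ := hval hz
    obtain ⟨hn, hspec⟩ := Dt.uniformize_spec z hz
    obtain ⟨hn', hspec'⟩ := Dt.uniformize_spec z' hz'
    have hσq : ∀ q : ℚ, σ (algebraMap ℚ ℂ q) = algebraMap ℚ ℂ q := fun q => by
      rw [eq_ratCast, map_ratCast]
    rw [hspec, hspec', WeierstrassCurve.Affine.Point.map_some,
      WeierstrassCurve.Affine.Point.some.injEq]
    refine ⟨?_, ?_⟩
    · simp only [RingHom.toRatAlgHom_apply, RingEquiv.coe_toRingHom, WeierstrassCurve.baseChange,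
        WeierstrassCurve.map_b₂, map_sub, map_div₀, map_ofNat, hσq, h₁]
    · simp only [RingHom.toRatAlgHom_apply, RingEquiv.coe_toRingHom, WeierstrassCurve.baseChange,
        WeierstrassCurve.map_b₂, WeierstrassCurve.map_a₁, WeierstrassCurve.map_a₃, map_sub,
        map_div₀, map_mul, map_ofNat, hσq, h₁, h₂]

/-- **`(g • P)_ℂ = σ ⋆ P_ℂ`** when `σ ∈ Aut(ℂ)` restricts to `g ∈ Aut_ℚ(K[n])` on `K[n] ⊂ ℂ`
(coordinatewise; copy of the private helper of `HeegnerTraceRelationDividingProofs`). [folklore] -/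
private theorem map_subtype_pointGalHom_eq {W : WeierstrassCurve ℚ} (ι : K →+* ℂ) {n : ℕ}
    (g : ringClassField K ι n ≃ₐ[ℚ] ringClassField K ι n) {σ : ℂ ≃+* ℂ}
    (hσ : ∀ x : ringClassField K ι n, σ x = ((g x : ringClassField K ι n) : ℂ))
    (P : (W.baseChange (ringClassField K ι n)).toAffine.Point) :
    WeierstrassCurve.Affine.Point.map (W' := W) (ringClassField K ι n).subtype.toRatAlgHom
        (pointGalHom W (ringClassField K ι n) g P) =
      WeierstrassCurve.Affine.Point.map (W' := W) (σ : ℂ →+* ℂ).toRatAlgHom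
        (WeierstrassCurve.Affine.Point.map (W' := W) (ringClassField K ι n).subtype.toRatAlgHom P) := by
  have h : (ringClassField K ι n).subtype.toRatAlgHom.comp
      (g : ringClassField K ι n →ₐ[ℚ] ringClassField K ι n) =
      (σ : ℂ →+* ℂ).toRatAlgHom.comp (ringClassField K ι n).subtype.toRatAlgHom :=
    AlgHom.ext fun x => (hσ x).symm
  rw [pointGalHom_apply, WeierstrassCurve.Affine.Point.map_map,
    WeierstrassCurve.Affine.Point.map_map, h]

/-- An automorphism of `ℂ` fixing `K[m]` pointwise fixes `ι(K) ⊆ K[m]`. [folklore] -/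
private theorem apply_eq_of_forall_mem_ringClassField (ι : K →+* ℂ) {m : ℕ} {σ : ℂ ≃+* ℂ}
    (hσ : ∀ x ∈ ringClassField K ι m, σ x = x) (k : K) : σ (ι k) = ι k :=
  hσ (ι k) (by
    rw [← coe_algebraMap_ringClassField ι m k]
    exact (algebraMap K (ringClassField K ι m) k).2)

/-- **Every `g ∈ Gal(K[n]/K[m])` extends to an automorphism of `ℂ` over `K[m]`** (`m ∣ n`, `n ≥ 1`;
`exists_ringEquiv_apply_eq_algEquiv`; copy of the private helper of `HeegnerTraceRelationDividingProofs`).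
[cite: GrossLMS1991, §3 (proof of Prop. 3.7: conjugates of x_n over K_m)] -/
private theorem exists_ringEquiv_extends_of_mem_ringClassGalOver (hK : IsImaginaryQuadratic K)
    (ι : K →+* ℂ) {m n : ℕ} (hmn : m ∣ n) (hn : n ≠ 0)
    {g : ringClassField K ι n ≃ₐ[ℚ] ringClassField K ι n} (hg : g ∈ ringClassGalOver ι n m) :
    ∃ σ : ℂ ≃+* ℂ, (∀ x ∈ ringClassField K ι m, σ x = x) ∧
      ∀ x : ringClassField K ι n, σ x = ((g x : ringClassField K ι n) : ℂ) := by
  letI : Algebra K ℂ := ι.toAlgebra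
  have hg' : ∀ y ∈ {x : ringClassField K ι n | (x : ℂ) ∈ ringClassField K ι m}, g • y = y :=
    (_root_.mem_fixingSubgroup_iff
      (M := ringClassField K ι n ≃ₐ[ℚ] ringClassField K ι n)).mp hg
  let g' : ringClassField K ι n ≃ₐ[subfieldIn ι n m] ringClassField K ι n :=
    { (g : ringClassField K ι n ≃+* ringClassField K ι n) with
      commutes' := fun r => hg' r.1 ((mem_subfieldIn_iff ι n m r.1).mp r.2) }
  obtain ⟨σ, hσm, hσn⟩ := exists_ringEquiv_apply_eq_algEquiv hK ι hmn hn g'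
  exact ⟨σ, hσm, fun x => hσn x⟩

/-! ## §4 The adapter `G_p → Fin p` (every prime `p ∣ m`, `p ∣ N` allowed) -/

/-- **The `G_p` adapter at any prime `p ∣ m`** (Gross 1991 §3: "the points in the divisor `T_ℓ(x_m)` are the
conjugates of `x_n` over `K_m`"; for `p ∣ N` read `U_p(x(m))`). For `K` imaginary quadratic, `ι : K → ℂ`,
`4N ∣ β² − d_K`, `p` a prime with `p ∣ m`, `m ≥ 1` — no `gcd(N, p m d_K) = 1` — there are, for the
elements `g` of `G_p = ringClassGalOver ι (pm) m`, automorphisms `σ_g ∈ Aut(ℂ)` with `σ_g|_{K[m]} = id`,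
`σ_g|_{K[pm]} = g`, and a BIJECTION `i : G_p → Fin p` with `LevelTransport N σ_g x(pm) ((x(m) + i g)/p)`
(injective by `eqOn_ringClassField_of_levelTransport_of_gamma0_smul_eq`, surjective by counting `#G_p = p`).
[cite: GrossLMS1991, §3 Prop. 3.7 (proof, PDF p. 217 l. 24 – p. 218 l. 1)] [cite: Darmon2004, Prop. 3.10 (proof, pp. 35–36)] -/
theorem exists_heckeOrbitIndex_bijective (hK : IsImaginaryQuadratic K) (ι : K →+* ℂ) {N : ℕ}
    [NeZero N] {β : ℤ} (hβ : (4 * N : ℤ) ∣ β ^ 2 - NumberField.discr K) {p m : ℕ} (hp : p.Prime)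
    (hpm : p ∣ m) (hm : m ≠ 0) [NeZero p] :
    ∃ (σ : ringClassGalOver ι (p * m) m → (ℂ ≃+* ℂ))
      (i : ringClassGalOver ι (p * m) m → Fin p),
      Function.Bijective i ∧
      ∀ g : ringClassGalOver ι (p * m) m,
        (∀ x ∈ ringClassField K ι m, σ g x = x) ∧
        (∀ x : ringClassField K ι (p * m),
          σ g x = (((g : ringClassField K ι (p * m) ≃ₐ[ℚ] ringClassField K ι (p * m)) x :
            ringClassField K ι (p * m)) : ℂ)) ∧
        LevelTransport N (σ g) (heegnerPointOfConductor (NumberField.discr K) β (p * m))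
          (tpB p (((i g : Fin p) : ℕ) : ℤ) • heegnerPointOfConductor (NumberField.discr K) β m) := by
  have hn : p * m ≠ 0 := mul_ne_zero hp.ne_zero hm
  have hmn : m ∣ p * m := dvd_mul_left m p
  -- Step 1: extensions `σ_g ∈ Aut(ℂ/K[m])` of the `g ∈ G_p`
  have hext : ∀ g : ringClassGalOver ι (p * m) m, ∃ σ : ℂ ≃+* ℂ,
      (∀ x ∈ ringClassField K ι m, σ x = x) ∧
        ∀ x : ringClassField K ι (p * m),
          σ x = (((g : ringClassField K ι (p * m) ≃ₐ[ℚ] ringClassField K ι (p * m)) x :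
            ringClassField K ι (p * m)) : ℂ) :=
    fun g => exists_ringEquiv_extends_of_mem_ringClassGalOver hK ι hmn hn g.2
  choose σ hσm hσn using hext
  have hσK : ∀ (g : ringClassGalOver ι (p * m) m) (k : K), σ g (ι k) = ι k :=
    fun g => apply_eq_of_forall_mem_ringClassField ι (hσm g)
  -- Step 2: `σ_g` carries `x(pm)` to some `(x(m) + i g)/p` (§2)
  have hidx : ∀ g : ringClassGalOver ι (p * m) m, ∃ j : Fin p,
      LevelTransport N (σ g) (heegnerPointOfConductor (NumberField.discr K) β (p * m))
        (tpB p ((j : ℕ) : ℤ) • heegnerPointOfConductor (NumberField.discr K) β m) :=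
    fun g => exists_levelTransport_tpB_of_fix_ringClassField hK ι hβ hp hpm hm (hσm g)
  choose i hi using hidx
  refine ⟨σ, i, ?_, fun g => ⟨hσm g, hσn g, hi g⟩⟩
  -- injectivity: equal targets force `σ_g = σ_{g'}` on `K[pm]`, i.e. `g = g'`
  have hinj : Function.Injective i := by
    intro g g' hgg'
    have h2 : ((1 : Gamma0 N) : SL(2, ℤ)) •
        (tpB p (((i g : Fin p) : ℕ) : ℤ) • heegnerPointOfConductor (NumberField.discr K) β m) =
        tpB p (((i g' : Fin p) : ℕ) : ℤ) • heegnerPointOfConductor (NumberField.discr K) β m := by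
      rw [hgg', Subgroup.coe_one, one_smul]
    have heq : Set.EqOn (σ g) (σ g') (ringClassField K ι (p * m)) :=
      eqOn_ringClassField_of_levelTransport_of_gamma0_smul_eq hK ι hβ hn (hσK g) (hσK g')
        (hi g) (hi g') h2
    apply Subtype.ext
    ext x
    have hx := heq x.2
    rw [hσn g x, hσn g' x] at hx
    exact_mod_cast hx
  -- surjectivity by counting: `#G_p = p = #Fin p`
  have hcard : Nat.card (ringClassGalOver ι (p * m) m) = p :=
    card_ringClassGalOver_eq_of_dvd hK ι hp hpm hm
  haveI : Finite (ringClassGalOver ι (p * m) m) :=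
    Nat.finite_of_card_ne_zero (by rw [hcard]; exact hp.ne_zero)
  haveI : Fintype (ringClassGalOver ι (p * m) m) := Fintype.ofFinite _
  refine (Fintype.bijective_iff_injective_and_card i).mpr ⟨hinj, ?_⟩
  rw [Fintype.card_fin, ← Nat.card_eq_fintype_card, hcard]

/-! ## §5 The relation in `E(ℂ)` -/

/-- **The Heegner trace relation at ANY prime `p ∣ m`, in `E(ℂ)` with `a_p = W.LFunction p`**: for `K` imaginary
quadratic, `4N ∣ β² − d_K`, a prime `p`, `p ∣ m` (`m ≥ 1`), any finset `G` enumerating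
`G_p = Gal(K[pm]/K[m])` and any `y ∈ E(K[pm])` lying over `y(pm) = φ(x(pm))`,
`(Σ_{g ∈ G} g • y)_ℂ = a_p • y(m)_ℂ − 𝟙_{p ∤ N} · y(m/p)_ℂ`. Proof: each `(g • y)_ℂ` is
`σ_g ⋆ φ(x(pm)) = φ((x(m) + i g)/p)` for the bijection `i : G_p → Fin p` of `exists_heckeOrbitIndex_bijective`;
reindex, apply the Hecke sum `lFunction_zsmul_φ` (all primes: `T_p = U_p` for `p ∣ N`), and identify
`φ(p·x(m)) = φ(x(m/p))`. For `p ∤ N` this is Darmon's Prop. 3.10 (case `ℓ ∣ n`) without `gcd(N, m) = 1`; for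
`p ∣ N` it is the `U_p` distribution relation of CM points of `p`-power conductor (Cornut–Vatsal 2007 §6).
[cite: Darmon2004, Prop. 3.10 (case ℓ ∣ n, pp. 35–36)] [cite: Knapp1993, Thm. 11.74 (b)]
[cite: CornutVatsal2007, §6.2 Lemma 6.5, §6.4 Lemma 6.14] -/
theorem map_sum_pointGalHom_eq_lFunction_smul_sub_ite (hK : IsImaginaryQuadratic K) (ι : K →+* ℂ)
    {N : ℕ} [NeZero N] {W : WeierstrassCurve ℚ} (Dt : ModularParametrizationData W N) {β : ℤ}
    (hβ : (4 * N : ℤ) ∣ β ^ 2 - NumberField.discr K) {p m : ℕ} (hp : p.Prime) (hpm : p ∣ m) (hm : m ≠ 0)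
    {G : Finset (ringClassField K ι (p * m) ≃ₐ[ℚ] ringClassField K ι (p * m))}
    (hG : ∀ g, g ∈ G ↔ g ∈ ringClassGalOver ι (p * m) m)
    {y : (W.baseChange (ringClassField K ι (p * m))).toAffine.Point}
    (hy : WeierstrassCurve.Affine.Point.map (W' := W)
        (ringClassField K ι (p * m)).subtype.toRatAlgHom y =
      heegnerPointComplexOfConductor Dt (NumberField.discr K) β (p * m)) :
    WeierstrassCurve.Affine.Point.map (W' := W) (ringClassField K ι (p * m)).subtype.toRatAlgHom
        (∑ g ∈ G, pointGalHom W (ringClassField K ι (p * m)) g y) =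
      W.LFunction p • heegnerPointComplexOfConductor Dt (NumberField.discr K) β m -
        if p ∣ N then 0 else heegnerPointComplexOfConductor Dt (NumberField.discr K) β (m / p) := by
  haveI : NeZero p := ⟨hp.ne_zero⟩
  obtain ⟨σ, i, hi, hσ⟩ := exists_heckeOrbitIndex_bijective hK ι hβ hp hpm hm
  -- the `p` conductor-`pm` points `(x(m) + j)/p`, indexed by `Fin p`
  let F : Fin p → (W.baseChange ℂ).toAffine.Point := fun j =>
    Dt.φ (tpB p ((j : ℕ) : ℤ) • heegnerPointOfConductor (NumberField.discr K) β m)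
  have hterm : ∀ g (hg : g ∈ G),
      WeierstrassCurve.Affine.Point.map (W' := W) (ringClassField K ι (p * m)).subtype.toRatAlgHom
          (pointGalHom W (ringClassField K ι (p * m)) g y) = F (i ⟨g, (hG g).1 hg⟩) := by
    intro g hg
    obtain ⟨-, hext, hT⟩ := hσ ⟨g, (hG g).1 hg⟩
    rw [map_subtype_pointGalHom_eq ι g hext y, hy, heegnerPointComplexOfConductor]
    exact map_φ_of_levelTransport Dt hT
  have hsum : ∑ j : Fin p, F j =
      W.LFunction p • heegnerPointComplexOfConductor Dt (NumberField.discr K) β m -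
        if p ∣ N then 0 else heegnerPointComplexOfConductor Dt (NumberField.discr K) β (m / p) := by
    rw [eq_sub_iff_add_eq, heegnerPointComplexOfConductor, heegnerPointComplexOfConductor,
      ← tpD_smul_heegnerPointOfConductor hK.discr_neg (four_dvd_of_dvd hβ) hpm hm,
      Dt.lFunction_zsmul_φ p hp]
  rw [map_sum, Finset.sum_bij (t := Finset.univ) (g := F) (fun g hg => i ⟨g, (hG g).1 hg⟩)
    (fun _ _ => Finset.mem_univ _)
    (fun a₁ ha₁ a₂ ha₂ h => congrArg Subtype.val (hi.1 h))
    (fun b _ => by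
      obtain ⟨⟨a, ha⟩, rfl⟩ := hi.2 b
      exact ⟨a, (hG a).2 ha, rfl⟩)
    hterm, hsum]

/-- **The relation at a prime `p ∣ N` DIVIDING THE LEVEL** (`T_p = U_p`): for `p ∣ N`, `p ∣ m`, any finset
`G` enumerating `Gal(K[pm]/K[m])` and any `y ∈ E(K[pm])` over `y(pm)`,
`(Σ_{g ∈ G} g • y)_ℂ = a_p(W) • y(m)_ℂ` — the `p` conjugates of `x(pm)` over `K[m]` form the divisor
`U_p(x(m))` and `U_p f = a_p f`. [cite: CornutVatsal2007, §6.2 Lemma 6.5, §6.4 Lemma 6.14]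
[cite: Knapp1993, Thm. 11.74 (b)] -/
theorem map_sum_pointGalHom_eq_lFunction_smul_of_dvd_level (hK : IsImaginaryQuadratic K) (ι : K →+* ℂ)
    {N : ℕ} [NeZero N] {W : WeierstrassCurve ℚ} (Dt : ModularParametrizationData W N) {β : ℤ}
    (hβ : (4 * N : ℤ) ∣ β ^ 2 - NumberField.discr K) {p m : ℕ} (hp : p.Prime) (hpN : p ∣ N)
    (hpm : p ∣ m) (hm : m ≠ 0)
    {G : Finset (ringClassField K ι (p * m) ≃ₐ[ℚ] ringClassField K ι (p * m))}
    (hG : ∀ g, g ∈ G ↔ g ∈ ringClassGalOver ι (p * m) m)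
    {y : (W.baseChange (ringClassField K ι (p * m))).toAffine.Point}
    (hy : WeierstrassCurve.Affine.Point.map (W' := W)
        (ringClassField K ι (p * m)).subtype.toRatAlgHom y =
      heegnerPointComplexOfConductor Dt (NumberField.discr K) β (p * m)) :
    WeierstrassCurve.Affine.Point.map (W' := W) (ringClassField K ι (p * m)).subtype.toRatAlgHom
        (∑ g ∈ G, pointGalHom W (ringClassField K ι (p * m)) g y) =
      W.LFunction p • heegnerPointComplexOfConductor Dt (NumberField.discr K) β m := by
  rw [map_sum_pointGalHom_eq_lFunction_smul_sub_ite hK ι Dt hβ hp hpm hm hG hy, if_pos hpN, sub_zero]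

/-- **The `∑ᶠ` form at a prime dividing the level.** For `p ∣ N`, `p ∣ m`, `m ≥ 1`, a level `n = p * m` and
any `y ∈ E(K[n])` over `y(n)`: `∑ᶠ σ ∈ Gal(K[n]/K[m]), (σ • y)_ℂ = a_p(W) • y(m)_ℂ`, `a_p(W) = W.LFunction p`
(the `p`-th coefficient of `L(E, s)`: `0` at an additive `p`, `±1` at a multiplicative `p`).
[cite: CornutVatsal2007, §6.4 Lemma 6.14 and §4.3 Lemma 4.9] [cite: Knapp1993, Thm. 11.74 (b)] -/
theorem finsum_mem_ringClassGalOver_eq_lFunction_smul_of_dvd_level (hK : IsImaginaryQuadratic K)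
    (ι : K →+* ℂ) {N : ℕ} [NeZero N] {W : WeierstrassCurve ℚ} (Dt : ModularParametrizationData W N)
    {β : ℤ} (hβ : (4 * N : ℤ) ∣ β ^ 2 - NumberField.discr K) {p m n : ℕ} (hp : p.Prime) (hpN : p ∣ N)
    (hpm : p ∣ m) (hm : m ≠ 0) (hn : p * m = n)
    {y : (W.baseChange (ringClassField K ι n)).toAffine.Point}
    (hy : WeierstrassCurve.Affine.Point.map (W' := W)
        (ringClassField K ι n).subtype.toRatAlgHom y =
      heegnerPointComplexOfConductor Dt (NumberField.discr K) β n) :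
    ∑ᶠ σ ∈ (ringClassGalOver ι n m : Set (ringClassField K ι n ≃ₐ[ℚ] ringClassField K ι n)),
        WeierstrassCurve.Affine.Point.map (W' := W) (ringClassField K ι n).subtype.toRatAlgHom
          (pointGalHom W (ringClassField K ι n) σ y) =
      W.LFunction p • heegnerPointComplexOfConductor Dt (NumberField.discr K) β m := by
  subst hn
  have hn0 : p * m ≠ 0 := mul_ne_zero hp.ne_zero hm
  haveI := (finiteDimensional_and_isGalois_ringClassField hK ι hn0).1
  haveI : FiniteDimensional ℚ (ringClassField K ι (p * m)) :=
    Module.Finite.trans K (ringClassField K ι (p * m))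
  have hfin : (ringClassGalOver ι (p * m) m : Set (ringClassField K ι (p * m) ≃ₐ[ℚ]
      ringClassField K ι (p * m))).Finite := Set.toFinite _
  have hG : ∀ g, g ∈ hfin.toFinset ↔ g ∈ ringClassGalOver ι (p * m) m := fun g => by
    rw [Set.Finite.mem_toFinset, SetLike.mem_coe]
  have key := map_sum_pointGalHom_eq_lFunction_smul_of_dvd_level hK ι Dt hβ hp hpN hpm hm hG hy
  rw [map_sum] at key
  rw [finsum_mem_eq_finite_toFinset_sum _ hfin]
  exact key

/-- **Trace ZERO when `a_p = 0`**: for `p ∣ N` with `W.LFunction p = 0`, `p ∣ m`, `n = p * m` and any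
`y ∈ E(K[n])` over `y(n)`, `∑ᶠ σ ∈ Gal(K[n]/K[m]), (σ • y)_ℂ = 0` — Cornut–Vatsal's Lemma 4.9 (iii) /
Lemma 6.14 ("`Tr(x) = 0` in the `P`-new quotient", `δ = v_p(N) ≥ 2`) for the principal points of an
elliptic curve over `ℚ`, as an EXACT vanishing in `E(ℂ)`. [cite: CornutVatsal2007, §4.3 Lemma 4.9 (iii) and §6.4 Lemma 6.14] -/
theorem finsum_mem_ringClassGalOver_eq_zero_of_lFunction_eq_zero (hK : IsImaginaryQuadratic K)
    (ι : K →+* ℂ) {N : ℕ} [NeZero N] {W : WeierstrassCurve ℚ} (Dt : ModularParametrizationData W N)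
    {β : ℤ} (hβ : (4 * N : ℤ) ∣ β ^ 2 - NumberField.discr K) {p m n : ℕ} (hp : p.Prime) (hpN : p ∣ N)
    (hap : W.LFunction p = 0) (hpm : p ∣ m) (hm : m ≠ 0) (hn : p * m = n)
    {y : (W.baseChange (ringClassField K ι n)).toAffine.Point}
    (hy : WeierstrassCurve.Affine.Point.map (W' := W)
        (ringClassField K ι n).subtype.toRatAlgHom y =
      heegnerPointComplexOfConductor Dt (NumberField.discr K) β n) :
    ∑ᶠ σ ∈ (ringClassGalOver ι n m : Set (ringClassField K ι n ≃ₐ[ℚ] ringClassField K ι n)),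
        WeierstrassCurve.Affine.Point.map (W' := W) (ringClassField K ι n).subtype.toRatAlgHom
          (pointGalHom W (ringClassField K ι n) σ y) = 0 := by
  rw [finsum_mem_ringClassGalOver_eq_lFunction_smul_of_dvd_level hK ι Dt hβ hp hpN hpm hm hn hy, hap,
    zero_zsmul]

/-! ## §6 (appended) Transport of the `p`-neighbour `x(pm) = x(m)/p` for ANY `m` — the two `j`-facts
as hypotheses (for `p ∤ m`: split / ramified `p`, where `[K[pm] : K[m]] ≠ p` and the non-membership of
`j(x(pm))` in `K[m]` comes from `HeegnerTraceRelationSplitProofs` / `…RamifiedProofs`) -/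

/-- **Transport of the `p`-neighbour `x(pm)`, general form.** As `exists_levelTransport_tpB_of_fix_ringClassField`,
but for ANY `m ≥ 1` (no `p ∣ m`): granted `j(x(pm)) ∉ K[m]` and `j(p·x(m)) ∈ K[m]` (for `p ∣ m` these are
`HeegnerTraceDividing.kleinJ_heegnerPointOfConductor_mul_not_mem_ringClassField` and
`…kleinJ_tpD_smul_mem_ringClassField`; for `p ∤ m` split, `p ≥ 3`, the first is
`HeegnerTraceSplit.kleinJ_heegnerPointOfConductor_mul_not_mem_ringClassField_of_split` and the second holds
because `p·x(m)` is the root of the primitive form `(A/p, B, pC)` of discriminant `m²d_K`), every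
`σ ∈ Aut(ℂ/K[m])` carries the level-`N` structure of `x(pm)` to that of `(x(m) + j)/p` for some `0 ≤ j < p`
— every prime `p`, `p ∣ N` allowed. Same proof (§1 classification + forced level partner + `j`-invariants).
[cite: GrossLMS1991, §3 (proof of Prop. 3.7: the points of T_ℓ(x_m) are the conjugates of x_n)]
[cite: CornutVatsal2007, §6.2 Lemma 6.5 (distribution relations of lattices)] -/
theorem exists_levelTransport_tpB_of_fix_ringClassField_of_kleinJ (hK : IsImaginaryQuadratic K)
    (ι : K →+* ℂ) {N : ℕ} [NeZero N] {β : ℤ} (hβ : (4 * N : ℤ) ∣ β ^ 2 - NumberField.discr K) {p m : ℕ}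
    (hp : p.Prime) (hm : m ≠ 0) [NeZero p] {σ : ℂ ≃+* ℂ} (hσ : ∀ x ∈ ringClassField K ι m, σ x = x)
    (hnot' : kleinJ (heegnerPointOfConductor (NumberField.discr K) β (p * m)) ∉ ringClassField K ι m)
    (hjD' : kleinJ (tpD p • heegnerPointOfConductor (NumberField.discr K) β m) ∈ ringClassField K ι m) :
    ∃ j : Fin p, LevelTransport N σ (heegnerPointOfConductor (NumberField.discr K) β (p * m))
      (tpB p ((j : ℕ) : ℤ) • heegnerPointOfConductor (NumberField.discr K) β m) := by
  set D : ℤ := NumberField.discr K with hDdef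
  set τ : ℍ := heegnerPointOfConductor D β m with hτdef
  have hD : D < 0 := hK.discr_neg
  have hp0 : (p : ℂ) ≠ 0 := by exact_mod_cast hp.ne_zero
  have ht : (τ : ℂ).im ≠ 0 := τ.im_pos.ne'
  have hτ₁ : heegnerPointOfConductor D β (p * m) = tpB p 0 • τ :=
    heegnerPointOfConductor_mul_eq_tpB_smul hD (four_dvd_of_dvd hβ) hm
  set τ₁ : ℍ := tpB p 0 • τ with hτ₁def
  have hcoe₁ : (τ₁ : ℂ) = (τ : ℂ) / p := by rw [hτ₁def, coe_tpB_smul, Int.cast_zero, add_zero]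
  -- the `j`-invariants in play
  have hnot : kleinJ τ₁ ∉ ringClassField K ι m := by rw [← hτ₁]; exact hnot'
  have hjτ : kleinJ τ ∈ ringClassField K ι m := kleinJ_heegnerPointOfConductor_mem_ringClassField hK ι hβ hm
  have hjD : kleinJ (tpD p • τ) ∈ ringClassField K ι m := hjD'
  -- self-transport of `x(m)` and the four transported lattices
  have hT0 : LevelTransport N σ τ τ :=
    levelTransport_heegnerPointOfConductor_self_of_fix_ringClassField hK ι hβ hm hσ
  obtain ⟨M, hM⟩ := exists_isTransportedBy σ (ofUpperHalfPlane τ)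
  obtain ⟨M_N, hMN⟩ := exists_isTransportedBy σ (ofUpperHalfPlane (levelPoint N τ))
  obtain ⟨c, hc, hMc, hMNc⟩ := hT0.exists_lattice_eq hM hMN
  obtain ⟨M₁, hM₁⟩ := exists_isTransportedBy σ (ofUpperHalfPlane τ₁)
  obtain ⟨M₁N, hM₁N⟩ := exists_isTransportedBy σ (ofUpperHalfPlane (levelPoint N τ₁))
  have hjM₁ : M₁.j = σ (kleinJ τ₁) := by rw [hM₁.j_eq, kleinJ_eq_periodPair_j]
  -- the lattices of `τ`, `τ₁` as spans
  have hΛ : (ofUpperHalfPlane τ).lattice = Submodule.span ℤ ({(τ : ℂ), 1} : Set ℂ) := rfl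
  have hΛN : (ofUpperHalfPlane (levelPoint N τ)).lattice =
      Submodule.span ℤ ({(N : ℂ) * τ, 1} : Set ℂ) := rfl
  have hΛ₁ : (ofUpperHalfPlane τ₁).lattice = Submodule.span ℤ ({(τ : ℂ) / p, 1} : Set ℂ) := by
    change Submodule.span ℤ ({(τ₁ : ℂ), 1} : Set ℂ) = _; rw [hcoe₁]
  have hΛ₁N : (ofUpperHalfPlane (levelPoint N τ₁)).lattice =
      Submodule.span ℤ ({(N : ℂ) * τ / p, 1} : Set ℂ) := by
    change Submodule.span ℤ ({((levelPoint N τ₁ : ℍ) : ℂ), 1} : Set ℂ) = _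
    rw [coe_levelPoint, hcoe₁, mul_div_assoc]
  -- `L = c⁻¹ Λ_{τ₁}^σ` lies between `Λ_τ` and `p⁻¹Λ_τ`
  set L : PeriodPair := M₁.mulLeft c⁻¹ (inv_ne_zero hc) with hLdef
  have hmemL : ∀ x, x ∈ L.lattice ↔ c * x ∈ M₁.lattice := fun x => by
    rw [hLdef, mem_mulLeft_lattice, inv_inv]
  have hle₁ : M.lattice ≤ M₁.lattice := hM.le hM₁ (by rw [hΛ, hΛ₁]; exact span_le_span_div _ hp0)
  have hmul₁ : ∀ x ∈ M₁.lattice, (p : ℂ) * x ∈ M.lattice := by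
    have h := hM₁.mul_mem hM (c := (p : ℂ)) (by rw [hΛ, hΛ₁]; exact mul_mem_span_of_mem_span_div _ hp0)
    rwa [map_natCast] at h
  have h1 : Submodule.span ℤ ({(τ : ℂ), 1} : Set ℂ) ≤ L.lattice := by
    intro x hx
    rw [hmemL]
    exact hle₁ (hMc ▸ mul_mem_mulLeft_lattice.mpr (hΛ ▸ hx))
  have h2 : ∀ x ∈ L.lattice, (p : ℂ) * x ∈ Submodule.span ℤ ({(τ : ℂ), 1} : Set ℂ) := by
    intro x hx
    rw [hmemL] at hx
    have h := hmul₁ _ hx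
    rw [hMc, mem_mulLeft_lattice, mul_left_comm, inv_mul_cancel_left₀ hc] at h
    exact h
  have hjL : L.j = σ (kleinJ τ₁) := by rw [hLdef, j_mulLeft, hjM₁]
  -- classify `L`; three cases contradict `j(x(pm)) ∉ K[m]`
  rcases classify_sublattice ht hp h1 h2 with ⟨j, hj0, hjp, hLj⟩ | hLD | hLinv | hLΛ
  rotate_left
  · -- `L = ℤτ + ℤp⁻¹ = p⁻¹Λ_{pτ}`: `j(L) = j(p·x(m)) = j(x(m/p)) ∈ K[m]`
    exfalso
    apply hnot
    refine mem_of_apply_eq_of_mem hσ (hjL.symm.trans ?_) hjD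
    have hlat : L.lattice = ((ofUpperHalfPlane (tpD p • τ)).mulLeft (p : ℂ)⁻¹ (inv_ne_zero hp0)).lattice := by
      rw [hLD]
      change _ = Submodule.span ℤ ({(p : ℂ)⁻¹ * ((tpD p • τ : ℍ) : ℂ), (p : ℂ)⁻¹ * 1} : Set ℂ)
      rw [coe_tpD_smul, inv_mul_cancel_left₀ hp0, mul_one]
    rw [j_eq_of_lattice_eq hlat, j_mulLeft, kleinJ_eq_periodPair_j]
  · -- `L ⊇ p⁻¹Λ_τ`, so `L = p⁻¹Λ_τ`: `j(L) = j(x(m)) ∈ K[m]`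
    exfalso
    apply hnot
    refine mem_of_apply_eq_of_mem hσ (hjL.symm.trans ?_) hjτ
    have hlat : L.lattice = ((ofUpperHalfPlane τ).mulLeft (p : ℂ)⁻¹ (inv_ne_zero hp0)).lattice := by
      ext x
      rw [mem_mulLeft_lattice (L := ofUpperHalfPlane τ) (c := (p : ℂ)⁻¹), inv_inv]
      constructor
      · exact h2 x
      · intro hx
        have h := hLinv _ hx
        rwa [inv_mul_cancel_left₀ hp0] at h
    rw [j_eq_of_lattice_eq hlat, j_mulLeft, kleinJ_eq_periodPair_j]
  · -- `L = Λ_τ`: `j(L) = j(x(m)) ∈ K[m]`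
    exfalso
    apply hnot
    refine mem_of_apply_eq_of_mem hσ (hjL.symm.trans ?_) hjτ
    rw [j_eq_of_lattice_eq (hLΛ.trans hΛ.symm), kleinJ_eq_periodPair_j]
  -- the good case: `L = ℤ(τ + j)/p + ℤ = Λ_{(x(m)+j)/p}`
  set τj : ℍ := tpB p j • τ with hτjdef
  have hcoej : (τj : ℂ) = ((τ : ℂ) + j) / p := by rw [hτjdef, coe_tpB_smul]
  have hΛj : (ofUpperHalfPlane τj).lattice = Submodule.span ℤ ({((τ : ℂ) + j) / p, 1} : Set ℂ) := by
    change Submodule.span ℤ ({(τj : ℂ), 1} : Set ℂ) = _; rw [hcoej]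
  have hΛjN : (ofUpperHalfPlane (levelPoint N τj)).lattice =
      Submodule.span ℤ ({(N : ℂ) * (((τ : ℂ) + j) / p), 1} : Set ℂ) := by
    change Submodule.span ℤ ({((levelPoint N τj : ℍ) : ℂ), 1} : Set ℂ) = _
    rw [coe_levelPoint, hcoej]
  have hM₁eq : M₁.lattice = ((ofUpperHalfPlane τj).mulLeft c hc).lattice := by
    ext x
    rw [mem_mulLeft_lattice, hΛj, ← hLj, hmemL, mul_inv_cancel_left₀ hc]
  -- the level partner `L_N = c⁻¹ Λ_{Nτ₁}^σ`
  set LN : PeriodPair := M₁N.mulLeft c⁻¹ (inv_ne_zero hc) with hLNdef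
  have hmemLN : ∀ x, x ∈ LN.lattice ↔ c * x ∈ M₁N.lattice := fun x => by
    rw [hLNdef, mem_mulLeft_lattice, inv_inv]
  have hN1 : (1 : ℂ) ∈ LN.lattice := by
    rw [hmemLN]
    have hle : M_N.lattice ≤ M₁N.lattice := hMN.le hM₁N (by
      rw [hΛN, hΛ₁N]
      exact span_le_span_div _ hp0)
    refine hle ?_
    rw [hMNc]
    exact mul_mem_mulLeft_lattice.mpr (ω₂_mem_lattice _)
  have hN2 : ∀ x ∈ LN.lattice, (p : ℂ) * x ∈ Submodule.span ℤ ({(N : ℂ) * τ, 1} : Set ℂ) := by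
    intro x hx
    rw [hmemLN] at hx
    have hmul : ∀ y ∈ M₁N.lattice, (p : ℂ) * y ∈ M_N.lattice := by
      have h := hM₁N.mul_mem hMN (c := (p : ℂ)) (by
        rw [hΛN, hΛ₁N]
        exact mul_mem_span_of_mem_span_div _ hp0)
      rwa [map_natCast] at h
    have h := hmul _ hx
    rw [hMNc, mem_mulLeft_lattice, mul_left_comm, inv_mul_cancel_left₀ hc] at h
    exact h
  have hN3 : LN.lattice ≤ Submodule.span ℤ ({((τ : ℂ) + j) / p, 1} : Set ℂ) := by
    intro x hx
    rw [hmemLN] at hx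
    rw [← hLj, hmemL]
    exact hM₁N.le hM₁ (lattice_levelPoint_le τ₁) hx
  have hN4 : (N : ℂ) * (((τ : ℂ) + j) / p) ∈ LN.lattice := by
    rw [hmemLN]
    have hmem : c * (((τ : ℂ) + j) / p) ∈ M₁.lattice := by
      rw [← hmemL, hLj]
      exact self_mem_span _
    have h := hM₁.mul_mem hM₁N (c := (N : ℂ)) (natCast_mul_mem_lattice_levelPoint τ₁) _ hmem
    rw [map_natCast] at h
    convert h using 1
    ring
  have hLNeq := levelPartner_eq_span ht hp0 j hN1 hN2 hN3 hN4
  have hM₁Neq : M₁N.lattice = ((ofUpperHalfPlane (levelPoint N τj)).mulLeft c hc).lattice := by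
    ext x
    rw [mem_mulLeft_lattice, hΛjN, ← hLNeq, hmemLN, mul_inv_cancel_left₀ hc]
  refine ⟨⟨j.toNat, (Int.toNat_lt hj0).mpr hjp⟩, ?_⟩
  rw [hτ₁]
  simp only [Int.toNat_of_nonneg hj0]
  exact levelTransport_of_isTransportedBy hM₁ hM₁N hc hM₁eq hM₁Neq

end HeegnerTraceLevelDividing

end Literature.NumberTheory.EllipticCurves

end
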